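import Literature.NumberTheory.Weil1964.AdelicDoublingDiagonalLift
import HarnessLib

/-!
# The geometric frame of the doubling diagonal: how `ω(𝐫₀(δ g^Δ δ⁻¹))` and the doubling lift `S̃(g)` act,
# and the theta distribution through them

Topic `NumberTheory/Weil1964`; namespace `Literature.NumberTheory.Weil1964`.  KERNEL MATHEMATICS ONLY: definitions
with bodies and theorems; no `def … : Prop` record, no `axiom`, no proof hole.  Sequel of `AdelicDoublingDiagonalLift`
(Li's rational `δ` carrying the diagonal `W^Δ` of `W ⊕ W⁻` onto `𝕐`, `g ↦ δ g^Δ δ⁻¹ ∈ P_𝕐`, the doubling lift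
`S̃(g) = r_F(δ)⁻¹ · 𝐫₀(δ g^Δ δ⁻¹) · r_F(δ)`); cell `hodgecm-mathlib`, floor-0 line P4, engine E-2, row I-STRUCT-I.

THE MATHEMATICS.  In the doubling method ([GelbartPiatetskishapiroRallis1987, Part A §2], [Li1992, p. 181],
[Kudla1996, V.3]) the diagonal `g^Δ = (g, g)` of `Sp(W)` preserves the transverse Lagrangians `W^Δ` and `W^∇`
(anti-diagonal) of `W ⊕ W⁻`; in a frame carrying `(W^∇, W^Δ)` onto `(𝕏, 𝕐)` it lies in the LEVI of `P_𝕐` and Weil's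
`𝐫₀` [Weil1964, Chap. I n° 13] lets it act GEOMETRICALLY.  The tree's `δ` (`deltaDiag`) carries `W^Δ` onto `𝕐` but
`δ⁻¹(𝕏) = X ⊕ Y⁻ ≠ W^∇`, so `δ g^Δ δ⁻¹` has a unipotent part; this file computes it in closed form.
* §1 (any commutative ring `K`, Gram matrix `T`, `IsUnit T.det`, doubled Gram matrix `T ⊕ (−T)`):
  `δ((x₁,x₂),(y₁,y₂)) = ((x₁ − x₂, T(y₁ − y₂)), (y₁, T⁻¹x₂))`, `δ⁻¹((x₁,x₂),0) = ((x₁,0),(0,−T⁻¹x₂))`; for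
  `p = δ g^Δ δ⁻¹` the `𝕏`-block of `p((x₁,x₂), 0)` is `θ_T(g(θ_T⁻¹ x))`, `θ_T(c₁,c₂) = (c₁, T c₂)` the Darboux map
  (`fst_doublingConj_apply_inl`), and THE COBOUNDARY IDENTITY `β_{T⊕−T}(u, v) = u|₁ ⬝ u|₂ − x₁ ⬝ x₂` for
  `(u, v) = p((x₁,x₂),0)` (`toLinearMap₂'_doublingConj_apply_inl`): the second-degree character of the unipotent
  part is the coboundary of `ψ ∘ q`, `q(z) = z|₁ ⬝ z|₂`, under the `𝕏`-block — one application of `g ∈ Sp(W)`.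
* §2 (adelic, renumbered by `Fin (n + n)` as in `AdelicDoublingDiagonalLift` §4): the geometric action
  `diagAct : Sp(W_𝔸) →* GL(X□(𝔸))`, the split form `pairForm = q`, the rational frame matrix `frameHalfRat = C₀`
  with `sdForm C₀ = ½ q` (`sdForm_frameHalf`), the `𝕏`-block ∕ coboundary identities for
  `(δ g^Δ δ⁻¹)⁻¹(x, 0)` renumbered, THE OPERATOR FORMULA `(ω(𝐫₀(δ g^Δ δ⁻¹))Φ)(x) = ψ_F(½(q(a_{g⁻¹}x) − q x))·Φ(a_{g⁻¹}x)`
  (`coe_toOp_adelicSiegelLift_doublingParabolicFin`) and THE OPERATOR LAW `t(C₀) ∘ ω(𝐫₀(δ g^Δ δ⁻¹)) =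
  (· ∘ a_{g⁻¹}) ∘ t(C₀)` (`chirp_frameHalf_toOp_doublingParabolicFin`): on `t(C₀)Φ` the diagonal acts geometrically.
* §3 the doubling lift: `ω(r_F δ) ∘ ω(S̃ g) = ω(𝐫₀(δ g^Δ δ⁻¹)) ∘ ω(r_F δ)`, THE GEOMETRIC FRAME
  `geomFrame Ψ = Ψ♮ := t(C₀)(ω(r_F δ)Ψ)` (Schwartz–Bruhat; `Ψ♮(0) = (ω(r_Fδ)Ψ)(0)`; Weil's own frame `X = V ⊗ ℓ*`
  of [Weil1965, n° 52]), `(ω(S̃ g)Ψ)♮ = Ψ♮ ∘ a_{g⁻¹}` (`geomFrame_omega_doublingLift`), and THE THETA DISTRIBUTION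
  THROUGH THE DOUBLING LIFT `Θ(ω(S̃ g)Ψ) = Σ'_{ξ ∈ F^{n+n}} Ψ♮(a_{g⁻¹} ξ)` (`thetaDist_omega_doublingLift`,
  `hasSum_…`; `Θ` is `r_F(δ)`-invariant [Weil1964, Chap. III n° 41 Thm 6], the rational chirp is `1` on `F^{n+n}`).
`g` ranges over all of `Sp(W_𝔸)` (nothing here is about a unitary group); the dual-pair consumer specialises
`g := ι_V(h)`.  Proof style: kernel-level `congrArg`∕`convert` chains (generic `rw` on goals holding the operators
`ω(·)` is avoided: definitional unfolding of the lifts is expensive).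

## References
* [Weil1964] A. Weil, *Sur certains groupes d'opérateurs unitaires*, Acta Math. 111 (1964): Chap. I n° 13 p. 160
  (`𝐫₀`: `d₀(α)`, `t₀(f)`, `d₀(α)⁻¹ t₀(f) d₀(α) = t₀(f^α)`), Chap. III n° 41 Thm 6 p. 193 (`Θ` is `r_k`-invariant).
* [Weil1965] A. Weil, *Sur la formule de Siegel dans la théorie des groupes classiques*, Acta Math. 113 (1965),
  n° 52 (the theta integral of the doubled pair, unfolded over rational orbits).
* [Li1992] J.-S. Li, J. reine angew. Math. 428 (1992), p. 181 (the element `δ`).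
* [GelbartPiatetskishapiroRallis1987] Part A §2 pp. 7–9 (`G^d = (G × G) ∩ P`).
* [Kudla1996] S. S. Kudla, *Notes on the local theta correspondence*, I.2 (`A(m(a))`, `A(n(b))`), V.3 (doubling).
-/

set_option autoImplicit false

noncomputable section

namespace Literature.NumberTheory.Weil1964

open Literature.RepresentationTheory.HeisenbergGroup
open Literature.RepresentationTheory.HeisenbergGroup.SymplecticMatrix
open Literature.NumberTheory.Automorphic
open Literature.NumberTheory.Automorphic.UnitaryGroup (spReindex reindexW coe_spReindex_apply reindexW_apply
  reindexW_symm_apply toLinearMap₂'_reindex)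
open NumberField
open scoped Matrix

/-! ## §1 Generic: `δ` in closed form, the `𝕏`-block and the coboundary identity of `δ g^Δ δ⁻¹` -/

section Generic

variable {K : Type*} [CommRing K] {ι : Type*} [Fintype ι] [DecidableEq ι] (T : Matrix ι ι K) (hT : IsUnit T.det)

local notation "𝕎" => (ι → K) × (ι → K)
local notation "𝕎₂" => (ι ⊕ ι → K) × (ι ⊕ ι → K)
local notation "Sp𝕎" => symplecticGroup (polar (Matrix.toLinearMap₂' K T))
local notation "T₂" => Matrix.fromBlocks T 0 0 (-T)
local notation "Sp𝕎₂" => symplecticGroup (polar (Matrix.toLinearMap₂' K (Matrix.fromBlocks T 0 0 (-T))))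

/-- **`δ` in closed form**: `δ((x₁, x₂), (y₁, y₂)) = ((x₁ − x₂, T(y₁ − y₂)), (y₁, T⁻¹ x₂))` on `W ⊕ W⁻`
(blocks `x = (x₁, x₂) ∈ 𝕏`, `y = (y₁, y₂) ∈ 𝕐`). [cite: Li1992, p. 181] -/
theorem doublingDelta_apply_sumElim (x₁ x₂ y₁ y₂ : ι → K) :
    ((doublingDelta T hT : Sp𝕎₂) : 𝕎₂ ≃ₗ[K] 𝕎₂) (Sum.elim x₁ x₂, Sum.elim y₁ y₂) =
      (Sum.elim (x₁ - x₂) (T *ᵥ (y₁ - y₂)), Sum.elim y₁ (T⁻¹ *ᵥ x₂)) := by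
  rw [doublingDelta, coe_transportSp_apply, coe_deltaDiag, darboux_apply]
  have h1 : Matrix.fromBlocks T 0 0 (-T) *ᵥ Sum.elim y₁ y₂ = Sum.elim (T *ᵥ y₁) (-(T *ᵥ y₂)) := by
    simp only [Matrix.fromBlocks_mulVec, Sum.elim_comp_inl, Sum.elim_comp_inr, Matrix.zero_mulVec,
      Matrix.neg_mulVec, add_zero, zero_add]
  have h2 : deltaDiagMatrix K ι *ᵥ Sum.elim (Sum.elim x₁ x₂) (Sum.elim (T *ᵥ y₁) (-(T *ᵥ y₂))) =
      Sum.elim (Sum.elim (x₁ - x₂) (T *ᵥ (y₁ - y₂))) (Sum.elim (T *ᵥ y₁) (-x₂)) := by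
    simp only [deltaDiagMatrix, Matrix.fromBlocks_mulVec, Sum.elim_comp_inl, Sum.elim_comp_inr, Matrix.one_mulVec,
      Matrix.neg_mulVec, Matrix.zero_mulVec, add_zero, zero_add, Matrix.mulVec_sub]
    funext i
    rcases i with (i | i) | (i | i) <;>
      simp only [Sum.elim_inl, Sum.elim_inr, Pi.add_apply, Pi.neg_apply, Pi.zero_apply, sub_eq_add_neg, add_zero,
        zero_add]
  have h3 : Sum.elim (T *ᵥ y₁) (-x₂) = Matrix.fromBlocks T 0 0 (-T) *ᵥ Sum.elim y₁ (T⁻¹ *ᵥ x₂) := by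
    simp only [Matrix.fromBlocks_mulVec, Sum.elim_comp_inl, Sum.elim_comp_inr, Matrix.zero_mulVec, zero_add,
      add_zero, Matrix.mulVec_mulVec, zero_mul, neg_mul, Matrix.mul_nonsing_inv T hT, Matrix.neg_mulVec,
      Matrix.one_mulVec]
  change (darboux _ (isUnit_det_fromBlocks_neg T hT)).symm
      (deltaDiagMatrix K ι *ᵥ Sum.elim (Sum.elim x₁ x₂) (Matrix.fromBlocks T 0 0 (-T) *ᵥ Sum.elim y₁ y₂)) = _
  rw [h1, h2, h3, darboux_symm_sumElim, Matrix.mulVec_mulVec, Matrix.nonsing_inv_mul _ (isUnit_det_fromBlocks_neg T hT),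
    Matrix.one_mulVec]

/-- **`δ⁻¹` on `𝕏`**: `δ⁻¹((x₁, x₂), 0) = ((x₁, 0), (0, −T⁻¹ x₂))` — the re-part of `W` plus the im-part of `W⁻`
(so `δ⁻¹(𝕏) = X ⊕ Y⁻`, NOT the anti-diagonal). [cite: Li1992, p. 181] -/
theorem doublingDelta_symm_apply_inl (x₁ x₂ : ι → K) :
    ((doublingDelta T hT : Sp𝕎₂) : 𝕎₂ ≃ₗ[K] 𝕎₂).symm (Sum.elim x₁ x₂, 0) =
      (Sum.elim x₁ (0 : ι → K), Sum.elim (0 : ι → K) (-(T⁻¹ *ᵥ x₂))) := by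
  rw [LinearEquiv.symm_apply_eq, doublingDelta_apply_sumElim]
  refine Prod.ext ?_ ?_
  · rw [sub_zero, zero_sub, neg_neg, Matrix.mulVec_mulVec, Matrix.mul_nonsing_inv T hT, Matrix.one_mulVec]
  · funext i
    rcases i with i | i
    · rfl
    · simp only [Pi.zero_apply, Sum.elim_inr, Matrix.mulVec_zero]

/-- `δ g^Δ δ⁻¹` on a vector of `𝕏`, in closed form: with `w₁ := g(x₁, 0)`, `w₂ := g(0, −T⁻¹x₂)`,
`(δ g^Δ δ⁻¹)((x₁,x₂), 0) = ((w₁.1 − w₂.1, T(w₁.2 − w₂.2)), (w₁.2, T⁻¹ w₂.1))`.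
[cite: GelbartPiatetskishapiroRallis1987, Part A §2 pp. 7–9] -/
theorem doublingConj_apply_inl (g : Sp𝕎) (x₁ x₂ : ι → K) :
    ((doublingConj T hT g : Sp𝕎₂) : 𝕎₂ ≃ₗ[K] 𝕎₂) (Sum.elim x₁ x₂, 0) =
      (Sum.elim (((g : 𝕎 ≃ₗ[K] 𝕎) (x₁, 0)).1 - ((g : 𝕎 ≃ₗ[K] 𝕎) (0, -(T⁻¹ *ᵥ x₂))).1)
          (T *ᵥ ((((g : 𝕎 ≃ₗ[K] 𝕎) (x₁, 0)).2 - ((g : 𝕎 ≃ₗ[K] 𝕎) (0, -(T⁻¹ *ᵥ x₂))).2))),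
        Sum.elim ((g : 𝕎 ≃ₗ[K] 𝕎) (x₁, 0)).2 (T⁻¹ *ᵥ ((g : 𝕎 ≃ₗ[K] 𝕎) (0, -(T⁻¹ *ᵥ x₂))).1)) := by
  have h : ((doublingConj T hT g : Sp𝕎₂) : 𝕎₂ ≃ₗ[K] 𝕎₂) (Sum.elim x₁ x₂, 0) =
      ((doublingDelta T hT : Sp𝕎₂) : 𝕎₂ ≃ₗ[K] 𝕎₂) (((spDiag T g : Sp𝕎₂) : 𝕎₂ ≃ₗ[K] 𝕎₂)
        (((doublingDelta T hT : Sp𝕎₂) : 𝕎₂ ≃ₗ[K] 𝕎₂).symm (Sum.elim x₁ x₂, 0))) := rfl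
  rw [h, doublingDelta_symm_apply_inl, coe_spDiag_apply]
  simp only [Sum.elim_comp_inl, Sum.elim_comp_inr]
  rw [doublingDelta_apply_sumElim]

/-- **the `𝕏`-block of `δ g^Δ δ⁻¹` is `g` in Darboux coordinates**: the first component of
`(δ g^Δ δ⁻¹)((x₁,x₂), 0)` is `θ_T(g(θ_T⁻¹(x₁,x₂)))`, `θ_T(c₁, c₂) = (c₁, T c₂)` (the Levi block `a_p` of
`p = δ g^Δ δ⁻¹`, cf. `SiegelParabolicPi.aMat`). [cite: GelbartPiatetskishapiroRallis1987, Part A §2 pp. 7–9] -/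
theorem fst_doublingConj_apply_inl (g : Sp𝕎) (x₁ x₂ : ι → K) :
    (((doublingConj T hT g : Sp𝕎₂) : 𝕎₂ ≃ₗ[K] 𝕎₂) (Sum.elim x₁ x₂, 0)).1 =
      darboux T hT ((g : 𝕎 ≃ₗ[K] 𝕎) ((darboux T hT).symm (Sum.elim x₁ x₂))) := by
  rw [doublingConj_apply_inl, darboux_symm_sumElim, darboux_apply]
  have hx : ((x₁, T⁻¹ *ᵥ x₂) : 𝕎) = (x₁, 0) - (0, -(T⁻¹ *ᵥ x₂)) := by
    refine Prod.ext ?_ ?_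
    · simp only [Prod.fst_sub, sub_zero]
    · simp only [Prod.snd_sub, zero_sub, neg_neg]
  rw [hx, map_sub, Prod.fst_sub, Prod.snd_sub]

/-- the same for `p⁻¹`: `((δ g^Δ δ⁻¹)⁻¹ (x, 0)).1 = θ_T(g⁻¹(θ_T⁻¹ x))` — Weil's `u` in `(u, v) = p⁻¹(x, 0)`, the
argument at which `ω(𝐫₀ p)Φ` evaluates `Φ` (`coe_toOp_adelicSiegelLift_symm`). [cite: Weil1964, Chap. I n° 13 p. 160] -/
theorem fst_doublingConj_symm_apply_inl (g : Sp𝕎) (x₁ x₂ : ι → K) :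
    (((doublingConj T hT g : Sp𝕎₂) : 𝕎₂ ≃ₗ[K] 𝕎₂).symm (Sum.elim x₁ x₂, 0)).1 =
      darboux T hT ((g : 𝕎 ≃ₗ[K] 𝕎).symm ((darboux T hT).symm (Sum.elim x₁ x₂))) := by
  have h : ((doublingConj T hT g : Sp𝕎₂) : 𝕎₂ ≃ₗ[K] 𝕎₂).symm (Sum.elim x₁ x₂, 0) =
      ((doublingConj T hT g⁻¹ : Sp𝕎₂) : 𝕎₂ ≃ₗ[K] 𝕎₂) (Sum.elim x₁ x₂, 0) := by
    rw [map_inv]; rfl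
  rw [h, fst_doublingConj_apply_inl]
  rfl

/-- **THE COBOUNDARY IDENTITY** for `p = δ g^Δ δ⁻¹`, `g ∈ Sp(W)`: with `(u, v) := p((x₁,x₂), 0)` (any `g`; apply it
to `g⁻¹` for `p⁻¹`), `β_{T⊕−T}(u, v) = u|_W ⬝ u|_{W⁻} − x₁ ⬝ x₂` where `u|_W ⬝ u|_{W⁻} = (u ∘ inl) ⬝ᵥ (u ∘ inr)`:
the second-degree character of the unipotent part of `δ g^Δ δ⁻¹` is the coboundary of `ψ(q)`, `q(z) = z₁ ⬝ z₂`,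
under the `𝕏`-block.  Proof: bilinearity and ONE application of `g ∈ Sp(W)` to the pair `((0, −T⁻¹x₂), (x₁, 0))`.
[cite: GelbartPiatetskishapiroRallis1987, Part A §2 pp. 7–9] -/
theorem toLinearMap₂'_doublingConj_apply_inl (g : Sp𝕎) (x₁ x₂ : ι → K) :
    Matrix.toLinearMap₂' K (Matrix.fromBlocks T 0 0 (-T))
        (((doublingConj T hT g : Sp𝕎₂) : 𝕎₂ ≃ₗ[K] 𝕎₂) (Sum.elim x₁ x₂, 0)).1
        (((doublingConj T hT g : Sp𝕎₂) : 𝕎₂ ≃ₗ[K] 𝕎₂) (Sum.elim x₁ x₂, 0)).2 =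
      ((((doublingConj T hT g : Sp𝕎₂) : 𝕎₂ ≃ₗ[K] 𝕎₂) (Sum.elim x₁ x₂, 0)).1 ∘ Sum.inl) ⬝ᵥ
          ((((doublingConj T hT g : Sp𝕎₂) : 𝕎₂ ≃ₗ[K] 𝕎₂) (Sum.elim x₁ x₂, 0)).1 ∘ Sum.inr) - x₁ ⬝ᵥ x₂ := by
  -- the symplectic identity of `g` on the pair `((0, −T⁻¹x₂), (x₁, 0))`
  have hg := (mem_symplecticGroup _ _).1 g.2 ((0 : ι → K), -(T⁻¹ *ᵥ x₂)) (x₁, (0 : ι → K))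
  simp only [polar_apply, Matrix.toLinearMap₂'_apply', Matrix.mulVec_zero, dotProduct_zero, Matrix.mulVec_neg,
    dotProduct_neg, Matrix.mulVec_mulVec, Matrix.mul_nonsing_inv T hT, Matrix.one_mulVec, zero_sub, neg_neg] at hg
  rw [doublingConj_apply_inl]
  simp only [Sum.elim_comp_inl, Sum.elim_comp_inr, Matrix.toLinearMap₂'_apply', Matrix.fromBlocks_mulVec,
    Matrix.zero_mulVec, zero_add, add_zero, Matrix.mulVec_mulVec, zero_mul, neg_mul, Matrix.mul_nonsing_inv T hT,
    Matrix.neg_mulVec, Matrix.one_mulVec, sumElim_dotProduct_sumElim, dotProduct_neg, Matrix.mulVec_sub,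
    dotProduct_sub, sub_dotProduct]
  rw [dotProduct_comm (T *ᵥ ((g : 𝕎 ≃ₗ[K] 𝕎) (x₁, 0)).2) ((g : 𝕎 ≃ₗ[K] 𝕎) (0, -(T⁻¹ *ᵥ x₂))).1,
    dotProduct_comm (T *ᵥ ((g : 𝕎 ≃ₗ[K] 𝕎) (0, -(T⁻¹ *ᵥ x₂))).2) ((g : 𝕎 ≃ₗ[K] 𝕎) (0, -(T⁻¹ *ᵥ x₂))).1]
  linear_combination -hg

end Generic

/-! ## §2 Adelic, renumbered by `Fin (n + n)`: the geometric action `a_g`, the frame chirp, the operator law -/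

section Adelic

variable (F : Type) [Field F] [NumberField F] {n : ℕ}
variable (T : Matrix (Fin n) (Fin n) (AdeleRing (𝓞 F) F)) (hT : IsUnit T.det)

local notation "𝔸F" => AdeleRing (𝓞 F) F
local notation "𝕎𝔸" => (Fin n → AdeleRing (𝓞 F) F) × (Fin n → AdeleRing (𝓞 F) F)
local notation "Sp𝔸" => symplecticGroup (polar (adelicForm F (Fin n) T))
local notation "T₂" => Matrix.fromBlocks T 0 0 (-T)
local notation "𝕋" => doubledGramFin F T
local notation "Sp𝕋" => symplecticGroup (polar (adelicForm F (Fin (n + n)) (doubledGramFin F T)))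
local notation "Sp𝕎₂A" => symplecticGroup (polar (Matrix.toLinearMap₂' (AdeleRing (𝓞 F) F) (Matrix.fromBlocks T 0 0 (-T))))
local notation "𝕏𝔸" => (Fin (n + n) → AdeleRing (𝓞 F) F)

/-- **the geometric action `a_g` of `g ∈ Sp(W_𝔸)` on `X□(𝔸) = 𝔸_F^{n+n}`**: `x ↦ θ_T(g(θ_T⁻¹ x))` renumbered by
`finSumFinEquiv` — the `𝕏`-block of `δ g^Δ δ⁻¹` (`fst_symm_doublingParabolicFin_apply_inl`), a homomorphism.
[cite: Kudla1996, I.2] -/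
def diagAct : Sp𝔸 →* (𝕏𝔸 ≃ₗ[𝔸F] 𝕏𝔸) where
  toFun g := (((LinearEquiv.funCongrLeft 𝔸F 𝔸F (finSumFinEquiv (m := n) (n := n))).trans (darboux T hT).symm).trans
      (g : 𝕎𝔸 ≃ₗ[𝔸F] 𝕎𝔸)).trans ((darboux T hT).trans (LinearEquiv.funCongrLeft 𝔸F 𝔸F finSumFinEquiv.symm))
  map_one' := LinearEquiv.ext fun x => by
    change (darboux T hT ((darboux T hT).symm (x ∘ ⇑finSumFinEquiv))) ∘ ⇑finSumFinEquiv.symm = x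
    rw [LinearEquiv.apply_symm_apply]
    funext i
    simp only [Function.comp_apply, Equiv.apply_symm_apply]
  map_mul' g h := LinearEquiv.ext fun x => by
    change (darboux T hT ((g : 𝕎𝔸 ≃ₗ[𝔸F] 𝕎𝔸) ((h : 𝕎𝔸 ≃ₗ[𝔸F] 𝕎𝔸) ((darboux T hT).symm (x ∘ ⇑finSumFinEquiv))))) ∘
        ⇑finSumFinEquiv.symm =
      (darboux T hT ((g : 𝕎𝔸 ≃ₗ[𝔸F] 𝕎𝔸) ((darboux T hT).symm
        (((darboux T hT ((h : 𝕎𝔸 ≃ₗ[𝔸F] 𝕎𝔸) ((darboux T hT).symm (x ∘ ⇑finSumFinEquiv)))) ∘ ⇑finSumFinEquiv.symm) ∘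
          ⇑finSumFinEquiv)))) ∘ ⇑finSumFinEquiv.symm
    rw [Function.comp_assoc, Equiv.symm_comp_self, Function.comp_id, LinearEquiv.symm_apply_apply]

/-- formula. [cite: Kudla1996, I.2] -/
theorem diagAct_apply (g : Sp𝔸) (x : 𝕏𝔸) :
    diagAct F T hT g x = (darboux T hT ((g : 𝕎𝔸 ≃ₗ[𝔸F] 𝕎𝔸) ((darboux T hT).symm (x ∘ ⇑finSumFinEquiv)))) ∘ ⇑finSumFinEquiv.symm :=
  rfl

/-- formula in the `Fin n ⊕ Fin n` enumeration. [cite: Kudla1996, I.2] -/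
theorem diagAct_apply_comp (g : Sp𝔸) (x : 𝕏𝔸) :
    (diagAct F T hT g x) ∘ ⇑finSumFinEquiv = darboux T hT ((g : 𝕎𝔸 ≃ₗ[𝔸F] 𝕎𝔸) ((darboux T hT).symm (x ∘ ⇑finSumFinEquiv))) := by
  rw [diagAct_apply, Function.comp_assoc, Equiv.symm_comp_self, Function.comp_id]

/-- **the split form `q(z) = z|₁ ⬝ z|₂`** on `X□(𝔸) = 𝔸_F^{n+n}` (first block dotted with second block). [folklore] -/
def pairForm (z : 𝕏𝔸) : 𝔸F := (fun i => z (Fin.castAdd n i)) ⬝ᵥ fun i => z (Fin.natAdd n i)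

/-- `q` in the `Fin n ⊕ Fin n` enumeration. [folklore] -/
private theorem pairForm_eq_comp (z : 𝕏𝔸) : pairForm F z = ((z ∘ ⇑finSumFinEquiv) ∘ Sum.inl) ⬝ᵥ ((z ∘ ⇑finSumFinEquiv) ∘ Sum.inr) := by
  simp only [pairForm, Function.comp_def, finSumFinEquiv_apply_left, finSumFinEquiv_apply_right]

/-- `q` of a vector written in the `Fin n ⊕ Fin n` enumeration. [folklore] -/
private theorem pairForm_comp_symm (u : Fin n ⊕ Fin n → 𝔸F) :
    pairForm F (u ∘ ⇑finSumFinEquiv.symm) = (u ∘ Sum.inl) ⬝ᵥ (u ∘ Sum.inr) := by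
  simp only [pairForm, Function.comp_def, finSumFinEquiv_symm_apply_castAdd, finSumFinEquiv_symm_apply_natAdd]

/-- **the rational frame matrix** `C₀ = (0 ½; 0 0)` (blocks, renumbered): `q_{C₀}(z) = ½ q(z)`. [folklore] -/
def frameHalfRat : Matrix (Fin (n + n)) (Fin (n + n)) F :=
  Matrix.reindex finSumFinEquiv finSumFinEquiv (Matrix.fromBlocks 0 (Matrix.diagonal fun _ => (2⁻¹ : F)) 0 0)

/-- **`q_{C₀}(z) = ½ · q(z)`**: the second-degree form of the frame matrix (a second-degree character `t₀(f)` of the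
parabolic). [cite: Weil1964, Chap. I n° 13 p. 160] -/
theorem sdForm_frameHalf (z : 𝕏𝔸) : sdForm F (ratMatrix F (frameHalfRat F)) z = ⅟(2 : 𝔸F) * pairForm F z := by
  -- write `z = w ∘ e⁻¹` with `w = z ∘ e = (z₁, z₂)`
  set w : Fin n ⊕ Fin n → 𝔸F := z ∘ ⇑(finSumFinEquiv (m := n) (n := n)) with hw
  have hz : z = w ∘ ⇑(finSumFinEquiv (m := n) (n := n)).symm := by
    rw [hw, Function.comp_assoc, Equiv.self_comp_symm, Function.comp_id]
  have hq : pairForm F z = (w ∘ Sum.inl) ⬝ᵥ (w ∘ Sum.inr) := by rw [hz, pairForm_comp_symm]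
  have hS : ratMatrix F (frameHalfRat F) =
      ((Matrix.fromBlocks 0 (Matrix.diagonal fun _ => (2⁻¹ : F)) 0 0).map (algebraMap F 𝔸F)).submatrix
        ⇑(finSumFinEquiv (m := n) (n := n)).symm ⇑(finSumFinEquiv (m := n) (n := n)).symm := rfl
  rw [hq, hz, sdForm, hS, Matrix.submatrix_vecMul_equiv, comp_equiv_dotProduct_comp_equiv]
  have h1 : (w ∘ ⇑(finSumFinEquiv (m := n) (n := n)).symm) ∘ ⇑(finSumFinEquiv (m := n) (n := n)).symm.symm = w := by
    rw [Equiv.symm_symm, Function.comp_assoc, Equiv.symm_comp_self, Function.comp_id]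
  rw [h1, Matrix.fromBlocks_map, Matrix.map_zero _ (map_zero _), Matrix.diagonal_map (map_zero _)]
  conv_lhs => rw [← Sum.elim_comp_inl_inr w]
  simp only [Matrix.vecMul_fromBlocks, Matrix.vecMul_zero, add_zero, zero_add, sumElim_dotProduct_sumElim,
    zero_dotProduct, Sum.elim_comp_inl, Sum.elim_comp_inr, ← invOf_two_eq_algebraMap]
  simp only [Matrix.vecMul_diagonal, dotProduct, Finset.mul_sum, Function.comp_apply]
  exact Finset.sum_congr rfl fun i _ => by ring

/-- `q_{C₀}` vanishes at `0`, so the frame chirp is `1` there. [folklore] -/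
private theorem sdChar_frameHalf_zero : sdChar F (ratMatrix F (frameHalfRat F)) (0 : 𝕏𝔸) = 1 := by
  have h0 : sdForm F (ratMatrix F (frameHalfRat F)) (0 : 𝕏𝔸) = 0 := by
    rw [sdForm, Matrix.zero_vecMul, zero_dotProduct]
  rw [sdChar, h0, AddChar.map_zero_eq_one, Circle.coe_one]

/-- `(δ g^Δ δ⁻¹)⁻¹` renumbered, as the reindexed `δ (g⁻¹)^Δ δ⁻¹`. [cite: GelbartPiatetskishapiroRallis1987, Part A §2 pp. 7–9] -/
theorem symm_doublingParabolicFin_apply (g : Sp𝔸) (v : 𝕏𝔸 × 𝕏𝔸) :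
    (((doublingParabolicFin F T hT g : siegelParabolicPi 𝕋) : Sp𝕋) : (𝕏𝔸 × 𝕏𝔸) ≃ₗ[𝔸F] (𝕏𝔸 × 𝕏𝔸)).symm v =
      reindexW 𝔸F finSumFinEquiv (((doublingConj T hT g⁻¹ : Sp𝕎₂A) : _ ≃ₗ[𝔸F] _)
        ((reindexW 𝔸F (finSumFinEquiv (m := n) (n := n))).symm v)) := by
  rw [map_inv (doublingConj T hT)]
  rfl

/-- **the `𝕏`-block of `(δ g^Δ δ⁻¹)⁻¹`** (renumbered): `((δ g^Δ δ⁻¹)⁻¹(x, 0)).1 = a_{g⁻¹} x`.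
[cite: GelbartPiatetskishapiroRallis1987, Part A §2 pp. 7–9] -/
theorem fst_symm_doublingParabolicFin_apply_inl (g : Sp𝔸) (x : 𝕏𝔸) :
    ((((doublingParabolicFin F T hT g : siegelParabolicPi 𝕋) : Sp𝕋) : (𝕏𝔸 × 𝕏𝔸) ≃ₗ[𝔸F] (𝕏𝔸 × 𝕏𝔸)).symm (x, 0)).1 =
      diagAct F T hT g⁻¹ x := by
  rw [symm_doublingParabolicFin_apply, reindexW_symm_apply, reindexW_apply]
  dsimp only
  rw [Pi.zero_comp, ← Sum.elim_comp_inl_inr (x ∘ ⇑finSumFinEquiv), fst_doublingConj_apply_inl, Sum.elim_comp_inl_inr,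
    diagAct_apply]

/-- **the second-degree character of `(δ g^Δ δ⁻¹)⁻¹` is the coboundary of `q`** (renumbered): with
`(u, v) := (δ g^Δ δ⁻¹)⁻¹(x, 0)`, `β_𝕋(u, v) = q(a_{g⁻¹} x) − q(x)`.
[cite: GelbartPiatetskishapiroRallis1987, Part A §2 pp. 7–9] -/
theorem form_symm_doublingParabolicFin_apply_inl (g : Sp𝔸) (x : 𝕏𝔸) :
    ((((doublingParabolicFin F T hT g : siegelParabolicPi 𝕋) : Sp𝕋) : (𝕏𝔸 × 𝕏𝔸) ≃ₗ[𝔸F] (𝕏𝔸 × 𝕏𝔸)).symm (x, 0)).1 ⬝ᵥ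
        (𝕋 *ᵥ ((((doublingParabolicFin F T hT g : siegelParabolicPi 𝕋) : Sp𝕋) : (𝕏𝔸 × 𝕏𝔸) ≃ₗ[𝔸F] (𝕏𝔸 × 𝕏𝔸)).symm (x, 0)).2) =
      pairForm F (diagAct F T hT g⁻¹ x) - pairForm F x := by
  rw [symm_doublingParabolicFin_apply, reindexW_symm_apply, reindexW_apply]
  dsimp only
  rw [Pi.zero_comp, ← Matrix.toLinearMap₂'_apply', toLinearMap₂'_reindex,
    ← Sum.elim_comp_inl_inr (x ∘ ⇑finSumFinEquiv), toLinearMap₂'_doublingConj_apply_inl]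
  rw [diagAct_apply, pairForm_comp_symm, fst_doublingConj_apply_inl, Sum.elim_comp_inl_inr, ← pairForm_eq_comp]

/-- `ψ(q(x)) · (ψ(q(u) − q(x)) · c) = ψ(q(u)) · c`. [folklore] -/
private theorem sdChar_mul_adeleAddChar_sub_mul {m : ℕ} (S : Matrix (Fin m) (Fin m) 𝔸F)
    (x u : Fin m → 𝔸F) (c : ℂ) :
    sdChar F S x * ((adeleAddChar F (sdForm F S u - sdForm F S x) : ℂ) * c) = sdChar F S u * c := by
  rw [← mul_assoc, sdChar, sdChar, ← Circle.coe_mul, ← AddChar.map_add_eq_mul, add_sub_cancel]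

/-- **THE OPERATOR FORMULA of `ω(𝐫₀(δ g^Δ δ⁻¹))` in the frame**: `(ω(𝐫₀(δ g^Δ δ⁻¹))Φ)(x) = ψ_F(½(q(a_{g⁻¹}x) − q(x))) · Φ(a_{g⁻¹} x)`.
[cite: Weil1964, Chap. I n° 13 p. 160] [cite: Kudla1996, I.2] -/
theorem coe_toOp_adelicSiegelLift_doublingParabolicFin (g : Sp𝔸) (Φ : piSchwartzBruhat F (Fin (n + n))) (x : 𝕏𝔸) :
    ((MpPsi.toOp (adelicSchrodinger F (Fin (n + n)) 𝕋)
          (adelicSiegelLift F 𝕋 (isUnit_det_doubledGramFin F T hT) (doublingParabolicFin F T hT g)) Φ :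
            piSchwartzBruhat F (Fin (n + n))) : 𝕏𝔸 → ℂ) x =
      (adeleAddChar F (⅟(2 : 𝔸F) * (pairForm F (diagAct F T hT g⁻¹ x) - pairForm F x)) : ℂ) *
        (Φ : 𝕏𝔸 → ℂ) (diagAct F T hT g⁻¹ x) := by
  have h := coe_toOp_adelicSiegelLift_symm F 𝕋 (isUnit_det_doubledGramFin F T hT) (doublingParabolicFin F T hT g) Φ x
  convert h using 3
  · rw [form_symm_doublingParabolicFin_apply_inl F T hT g x]
  · exact (fst_symm_doublingParabolicFin_apply_inl F T hT g x).symm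

/-- **THE OPERATOR LAW**: `ψ_F(½q(x)) · (ω(𝐫₀(δ g^Δ δ⁻¹))Φ)(x) = ψ_F(½q(a_{g⁻¹}x)) · Φ(a_{g⁻¹}x)`, i.e.
`t(C₀) ∘ ω(𝐫₀(δ g^Δ δ⁻¹)) = (· ∘ a_{g⁻¹}) ∘ t(C₀)`: ON `t(C₀)Φ` THE DIAGONAL ACTS GEOMETRICALLY (Weil's
`d₀(α)⁻¹ t₀(f) d₀(α) = t₀(f^α)` for the coboundary of §1). [cite: Weil1964, Chap. I n° 13 p. 160] -/
theorem chirp_frameHalf_toOp_doublingParabolicFin (g : Sp𝔸) (Φ : piSchwartzBruhat F (Fin (n + n))) (x : 𝕏𝔸) :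
    chirp F (ratMatrix F (frameHalfRat F))
        ((MpPsi.toOp (adelicSchrodinger F (Fin (n + n)) 𝕋)
          (adelicSiegelLift F 𝕋 (isUnit_det_doubledGramFin F T hT) (doublingParabolicFin F T hT g)) Φ :
            piSchwartzBruhat F (Fin (n + n))) : 𝕏𝔸 → ℂ) x =
      chirp F (ratMatrix F (frameHalfRat F)) (Φ : 𝕏𝔸 → ℂ) (diagAct F T hT g⁻¹ x) := by
  have e : ⅟(2 : 𝔸F) * (pairForm F (diagAct F T hT g⁻¹ x) - pairForm F x) =
      sdForm F (ratMatrix F (frameHalfRat F)) (diagAct F T hT g⁻¹ x) - sdForm F (ratMatrix F (frameHalfRat F)) x := by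
    rw [sdForm_frameHalf, sdForm_frameHalf, mul_sub]
  rw [chirp_apply, chirp_apply]
  exact (congrArg (fun t : ℂ => sdChar F (ratMatrix F (frameHalfRat F)) x * t)
    (coe_toOp_adelicSiegelLift_doublingParabolicFin F T hT g Φ x)).trans
    ((congrArg (fun t : 𝔸F => sdChar F (ratMatrix F (frameHalfRat F)) x *
        ((adeleAddChar F t : ℂ) * (Φ : 𝕏𝔸 → ℂ) (diagAct F T hT g⁻¹ x))) e).trans
      (sdChar_mul_adeleAddChar_sub_mul F (ratMatrix F (frameHalfRat F)) x (diagAct F T hT g⁻¹ x)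
        ((Φ : 𝕏𝔸 → ℂ) (diagAct F T hT g⁻¹ x))))

end Adelic

/-! ## §3 The doubling lift through the frame, and the theta distribution -/

section Theta

variable (F : Type) [Field F] [NumberField F] {n : ℕ}
variable (T : Matrix (Fin n) (Fin n) (AdeleRing (𝓞 F) F)) (hT : IsUnit T.det)

local notation "𝔸F" => AdeleRing (𝓞 F) F
local notation "𝕎𝔸" => (Fin n → AdeleRing (𝓞 F) F) × (Fin n → AdeleRing (𝓞 F) F)
local notation "Sp𝔸" => symplecticGroup (polar (adelicForm F (Fin n) T))
local notation "𝕋" => doubledGramFin F T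
local notation "𝕏𝔸" => (Fin (n + n) → AdeleRing (𝓞 F) F)

/-- `a (a⁻¹ b a) = b a` in a group. [folklore] -/
private theorem mul_inv_mul_conj_aux {G : Type*} [Group G] (a b : G) : a * (a⁻¹ * b * a) = b * a := by
  rw [← mul_assoc, ← mul_assoc, mul_inv_cancel, one_mul]

/-- **`ω(r_F δ) ∘ ω(S̃ g) = ω(𝐫₀(δ g^Δ δ⁻¹)) ∘ ω(r_F δ)`** (`S̃(g) = r_F(δ)⁻¹ 𝐫₀(δ g^Δ δ⁻¹) r_F(δ)`).
[cite: Weil1964, Chap. I n° 13 p. 160] -/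
theorem omega_doublingDeltaLift_doublingLift (g : Sp𝔸) (Ψ : piSchwartzBruhat F (Fin (n + n))) :
    adelicMpCont.omega F (Fin (n + n)) 𝕋 (doublingDeltaLift F T hT)
        (adelicMpCont.omega F (Fin (n + n)) 𝕋 (doublingLift F T hT g) Ψ) =
      adelicMpCont.omega F (Fin (n + n)) 𝕋
        (adelicSiegelLiftCont F 𝕋 (isUnit_det_doubledGramFin F T hT) (doublingParabolicFin F T hT g))
        (adelicMpCont.omega F (Fin (n + n)) 𝕋 (doublingDeltaLift F T hT) Ψ) := by
  -- the group identity `δ̃ · S̃(g) = 𝐫₀(δ g^Δ δ⁻¹) · δ̃`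
  have e2 : doublingDeltaLift F T hT * doublingLift F T hT g =
      adelicSiegelLiftCont F 𝕋 (isUnit_det_doubledGramFin F T hT) (doublingParabolicFin F T hT g) * doublingDeltaLift F T hT :=
    (congrArg (doublingDeltaLift F T hT * ·) (doublingLift_apply F T hT g)).trans (mul_inv_mul_conj_aux _ _)
  have e1 := congrArg (fun f : Module.End ℂ (piSchwartzBruhat F (Fin (n + n))) => f Ψ)
    ((adelicMpCont.omega F (Fin (n + n)) 𝕋).map_mul (doublingDeltaLift F T hT) (doublingLift F T hT g))
  have e3 := congrArg (fun f : Module.End ℂ (piSchwartzBruhat F (Fin (n + n))) => f Ψ)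
    ((adelicMpCont.omega F (Fin (n + n)) 𝕋).map_mul
      (adelicSiegelLiftCont F 𝕋 (isUnit_det_doubledGramFin F T hT) (doublingParabolicFin F T hT g)) (doublingDeltaLift F T hT))
  exact e1.symm.trans ((congrArg (fun p => adelicMpCont.omega F (Fin (n + n)) 𝕋 p Ψ) e2).trans e3)

/-- **the geometric frame** `Ψ♮ := t(C₀)(ω(r_F δ)Ψ) = ψ_F(½ q) · Ψ^δ` — the Schwartz–Bruhat function on which the
doubling diagonal acts geometrically (`geomFrame_omega_doublingLift`); Weil's own frame `X = W^∇` of the doubled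
space. [cite: Weil1965, n° 52] -/
def geomFrame (Ψ : piSchwartzBruhat F (Fin (n + n))) : piSchwartzBruhat F (Fin (n + n)) :=
  chirpLM F (ratMatrix F (frameHalfRat F)) (adelicMpCont.omega F (Fin (n + n)) 𝕋 (doublingDeltaLift F T hT) Ψ)

/-- unfolding on underlying functions. [cite: Weil1965, n° 52] -/
theorem coe_geomFrame (Ψ : piSchwartzBruhat F (Fin (n + n))) :
    ((geomFrame F T hT Ψ : piSchwartzBruhat F (Fin (n + n))) : 𝕏𝔸 → ℂ) =
      chirp F (ratMatrix F (frameHalfRat F))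
        ((adelicMpCont.omega F (Fin (n + n)) 𝕋 (doublingDeltaLift F T hT) Ψ : piSchwartzBruhat F (Fin (n + n))) :
          𝕏𝔸 → ℂ) :=
  rfl

/-- `Ψ ↦ Ψ♮` is additive (the theta-side functionals built on it are linear). [cite: Weil1965, n° 52] -/
theorem geomFrame_add (Ψ Ψ' : piSchwartzBruhat F (Fin (n + n))) :
    geomFrame F T hT (Ψ + Ψ') = geomFrame F T hT Ψ + geomFrame F T hT Ψ' :=
  (congrArg (chirpLM F (ratMatrix F (frameHalfRat F)))
      ((adelicMpCont.omega F (Fin (n + n)) 𝕋 (doublingDeltaLift F T hT)).map_add Ψ Ψ')).trans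
    ((chirpLM F (ratMatrix F (frameHalfRat F))).map_add _ _)

/-- `Ψ ↦ Ψ♮` is homogeneous. [cite: Weil1965, n° 52] -/
theorem geomFrame_smul (a : ℂ) (Ψ : piSchwartzBruhat F (Fin (n + n))) :
    geomFrame F T hT (a • Ψ) = a • geomFrame F T hT Ψ :=
  (congrArg (chirpLM F (ratMatrix F (frameHalfRat F)))
      ((adelicMpCont.omega F (Fin (n + n)) 𝕋 (doublingDeltaLift F T hT)).map_smul a Ψ)).trans
    ((chirpLM F (ratMatrix F (frameHalfRat F))).map_smul _ _)

/-- **`Ψ♮(0) = (ω(r_F δ)Ψ)(0)`** — the Siegel–Weil section value is read equally in both frames. [cite: Weil1965, n° 52] -/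
theorem geomFrame_apply_zero (Ψ : piSchwartzBruhat F (Fin (n + n))) :
    ((geomFrame F T hT Ψ : piSchwartzBruhat F (Fin (n + n))) : 𝕏𝔸 → ℂ) 0 =
      ((adelicMpCont.omega F (Fin (n + n)) 𝕋 (doublingDeltaLift F T hT) Ψ : piSchwartzBruhat F (Fin (n + n))) :
        𝕏𝔸 → ℂ) 0 :=
  calc ((geomFrame F T hT Ψ : piSchwartzBruhat F (Fin (n + n))) : 𝕏𝔸 → ℂ) 0
      = sdChar F (ratMatrix F (frameHalfRat F)) 0 *
          ((adelicMpCont.omega F (Fin (n + n)) 𝕋 (doublingDeltaLift F T hT) Ψ : piSchwartzBruhat F (Fin (n + n))) :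
            𝕏𝔸 → ℂ) 0 := rfl
    _ = _ := (congrArg (· * _) (sdChar_frameHalf_zero F)).trans (one_mul _)

/-- **THE DOUBLING LIFT IN THE GEOMETRIC FRAME**: `(ω(S̃ g)Ψ)♮ = Ψ♮ ∘ a_{g⁻¹}` — on `Ψ♮` the diagonal `g^Δ` of
`Sp(W_𝔸)` acts by the geometric action `a_g` of `diagAct`. [cite: Weil1964, Chap. I n° 13 p. 160] -/
theorem geomFrame_omega_doublingLift (g : Sp𝔸) (Ψ : piSchwartzBruhat F (Fin (n + n))) (x : 𝕏𝔸) :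
    ((geomFrame F T hT (adelicMpCont.omega F (Fin (n + n)) 𝕋 (doublingLift F T hT g) Ψ) :
        piSchwartzBruhat F (Fin (n + n))) : 𝕏𝔸 → ℂ) x =
      ((geomFrame F T hT Ψ : piSchwartzBruhat F (Fin (n + n))) : 𝕏𝔸 → ℂ) (diagAct F T hT g⁻¹ x) :=
  (congrArg (fun Φ : piSchwartzBruhat F (Fin (n + n)) =>
      chirp F (ratMatrix F (frameHalfRat F)) (Φ : 𝕏𝔸 → ℂ) x) (omega_doublingDeltaLift_doublingLift F T hT g Ψ)).trans
    (chirp_frameHalf_toOp_doublingParabolicFin F T hT g _ x)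

/-- `(ω(S̃ g)Ψ)♮` as a function IS `Ψ♮ ∘ a_{g⁻¹}`. [cite: Weil1964, Chap. I n° 13 p. 160] -/
theorem coe_geomFrame_omega_doublingLift (g : Sp𝔸) (Ψ : piSchwartzBruhat F (Fin (n + n))) :
    ((geomFrame F T hT (adelicMpCont.omega F (Fin (n + n)) 𝕋 (doublingLift F T hT g) Ψ) :
        piSchwartzBruhat F (Fin (n + n))) : 𝕏𝔸 → ℂ) =
      fun x => ((geomFrame F T hT Ψ : piSchwartzBruhat F (Fin (n + n))) : 𝕏𝔸 → ℂ) (diagAct F T hT g⁻¹ x) :=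
  funext (geomFrame_omega_doublingLift F T hT g Ψ)

/-- `x ↦ Ψ♮(a_{g⁻¹} x)` is again a Schwartz–Bruhat function (it is `(ω(S̃ g)Ψ)♮`) — the input of Weil's Lemme 5
(uniform theta majorants on compacta). [cite: Weil1964, Chap. III n° 41, Lemme 5 p. 192] -/
theorem geomFrame_comp_diagAct_mem (g : Sp𝔸) (Ψ : piSchwartzBruhat F (Fin (n + n))) :
    (fun x => ((geomFrame F T hT Ψ : piSchwartzBruhat F (Fin (n + n))) : 𝕏𝔸 → ℂ) (diagAct F T hT g⁻¹ x)) ∈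
      piSchwartzBruhat F (Fin (n + n)) :=
  coe_geomFrame_omega_doublingLift F T hT g Ψ ▸ Subtype.coe_prop _

/-- **THE THETA DISTRIBUTION THROUGH THE DOUBLING LIFT**: `Θ(ω(S̃ g)Ψ) = Θ(Ψ♮ ∘ a_{g⁻¹})` — `Θ` is
`r_F(δ)`-invariant and blind to the rational chirp `t(C₀)`. [cite: Weil1964, Chap. III n° 41 Thm 6 p. 193] -/
theorem thetaDist_omega_doublingLift (g : Sp𝔸) (Ψ : piSchwartzBruhat F (Fin (n + n))) :
    thetaDist F (Fin (n + n))
        ((adelicMpCont.omega F (Fin (n + n)) 𝕋 (doublingLift F T hT g) Ψ : piSchwartzBruhat F (Fin (n + n))) : 𝕏𝔸 → ℂ) =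
      thetaDist F (Fin (n + n)) fun x =>
        ((geomFrame F T hT Ψ : piSchwartzBruhat F (Fin (n + n))) : 𝕏𝔸 → ℂ) (diagAct F T hT g⁻¹ x) := by
  -- `Θ(Ψ') = Θ(ω(r_Fδ)Ψ') = Θ(t(C₀) ω(r_Fδ) Ψ') = Θ((Ψ')♮)`, `Ψ' = ω(S̃ g)Ψ`, and `(Ψ')♮ = Ψ♮ ∘ a_{g⁻¹}`
  have h1 := thetaDist_chirp_ratMatrix (frameHalfRat F)
    ((adelicMpCont.omega F (Fin (n + n)) 𝕋 (doublingDeltaLift F T hT)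
      (adelicMpCont.omega F (Fin (n + n)) 𝕋 (doublingLift F T hT g) Ψ) : piSchwartzBruhat F (Fin (n + n))) : 𝕏𝔸 → ℂ)
  have h2 := thetaDist_omega_ratThetaLiftCont F 𝕋 (isUnit_det_doubledGramFin F T hT) (doublingDeltaRat F)
    (adelicMpCont.omega F (Fin (n + n)) 𝕋 (doublingLift F T hT g) Ψ)
  have h3 := congrArg (thetaDist F (Fin (n + n))) (coe_geomFrame_omega_doublingLift F T hT g Ψ)
  exact (h2.symm.trans h1.symm).trans h3

/-- **THE THETA DISTRIBUTION THROUGH THE DOUBLING LIFT, UNFOLDED over the rational points**: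
`Θ(ω(S̃ g)Ψ) = Σ_{ξ ∈ F^{n+n}} Ψ♮(a_{g⁻¹} ξ)`, absolutely convergent. [cite: Weil1965, n° 52] -/
theorem hasSum_thetaDist_omega_doublingLift (g : Sp𝔸) (Ψ : piSchwartzBruhat F (Fin (n + n))) :
    HasSum (fun ξ : Fin (n + n) → F =>
        ((geomFrame F T hT Ψ : piSchwartzBruhat F (Fin (n + n))) : 𝕏𝔸 → ℂ) (diagAct F T hT g⁻¹ (ratPt F (Fin (n + n)) ξ)))
      (thetaDist F (Fin (n + n))
        ((adelicMpCont.omega F (Fin (n + n)) 𝕋 (doublingLift F T hT g) Ψ : piSchwartzBruhat F (Fin (n + n))) : 𝕏𝔸 → ℂ)) := by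
  have h := hasSum_thetaDist (geomFrame_comp_diagAct_mem F T hT g Ψ)
  rw [← thetaDist_omega_doublingLift] at h
  exact h

/-- the summands are absolutely summable. [cite: Weil1964, Chap. III n° 41, Lemme 5 p. 192] -/
theorem summable_norm_geomFrame_diagAct_ratPt (g : Sp𝔸) (Ψ : piSchwartzBruhat F (Fin (n + n))) :
    Summable fun ξ : Fin (n + n) → F =>
      ‖((geomFrame F T hT Ψ : piSchwartzBruhat F (Fin (n + n))) : 𝕏𝔸 → ℂ) (diagAct F T hT g⁻¹ (ratPt F (Fin (n + n)) ξ))‖ := by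
  have h := summable_norm_ratPt (geomFrame_comp_diagAct_mem F T hT g Ψ)
  exact h

end Theta

end Literature.NumberTheory.Weil1964
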